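import Literature.Probability.LatticeModels.DobrushinComparisonBoundary
import HarnessLib

/-!
# Venture YMGap, track ROBUST-BALL — FINITE-VOLUME CLUSTERING UNIFORM IN THE VOLUME AND THE BOUNDARY
# CONDITION, step 1: the generic kernel covariance estimate in Dobrushin's regime (Vasserstein form)

HONEST FRAMING. WHAT THIS IS: a venture file (cell `pub-ymgap`, track Y2 ROBUST-BALL, seat ds-3, theorems only) with
the GENERIC half of the object «C-KMIX»: the finite-volume (kernel) twin of the tree's covariance estimate
`DobrushinMetric.abs_covariance_le_of_isKRContraction`. That theorem bounds `cov_μ(f, g)` for a GIBBS MEASURE `μ` of a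
specification `γ` satisfying Dobrushin's condition in the Vasserstein form (`IsKRContraction γ r nbr C`, weight
`0 ≤ r ≤ R`, row sums `≤ c`). Here the state is the FINITE-VOLUME KERNEL `γ_Λ(· | η)` itself, for an ARBITRARY finite
volume `Λ` and an ARBITRARY boundary condition `η`, and the bound is the same:

  `|cov_{γ_Λ(·|η)}(f, g)| ≤ 2 R² (Σ_y δ_y(g)) Σ_{y ∈ Δ_f} c^{ℓ y} δ_y(f)`      (`abs_covariance_kernel_le`)

for bounded measurable local `f, g` with coordinatewise `r`-Lipschitz bounds `δ_f, δ_g` and every profile `ℓ : V → ℕ`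
vanishing on the dependence set `Δ_g` of `g` with `ℓ x ≤ ℓ y + 1` for `x ∉ Δ_g`, `y ∈ nbr x` — UNIFORMLY in `Λ` and
`η` (no loss near the boundary of `Λ`): Föllmer's covariance theorem (1988, Ch. I, Thm. (2.13)) for the CONDITIONAL
specification (2.10) (the outside of `Λ` frozen at `η`), i.e. the covariance form of Dobrushin–Shlosman's
finite-volume mixing condition restricted to Lipschitz observables (Kantorovich form).
MECHANISM (everything generic is the tree's): `cov(f, g) = γ_Λ(g̃|η) · (γ_Λ^{g̃}(f|η) − γ_Λ(f|η))` for the tilt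
`γ_Λ^{g̃}(·|η) = g̃ γ_Λ(·|η) / γ_Λ(g̃|η)`, `g̃ = g − g(τ₀) + R Σ δ_g ∈ [0, 2R Σ δ_g]`. Both states are invariant under the
one-site kernels `γ_x`, `x ∈ Λ ∖ Δ_g` (consistency; consistency + properness — `g̃` does not read the spin at `x`), and
BOTH FREEZE THE OUTSIDE OF `Λ` AT `η` (properness), so the vector `R·𝟙_Λ` — not the constant `R` — is an initial
estimate (`isEstimate_kernel_tilt`); lit-1's sweep from a given estimate down to a super-solution
(`DustingData.abs_sub_le_sum_of_superSolution_of_estimate`) with the profile super-solution `R c^{ℓ}` then gives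
`|γ_Λ^{g̃}(f|η) − γ_Λ(f|η)| ≤ R Σ_{y ∈ Δ_f} c^{ℓ y} δ_y(f)` (`abs_tilt_sub_kernel_le`). The companion file
`KernelClusteringBall.lean` feeds the perturbed `SU(N)` specification of the tier-1 ball through it.
WHAT THIS IS NOT: not the total-variation (event) form of strong mixing, not a log-Sobolev inequality, not complete
analyticity in Dobrushin–Shlosman's full sense; an abstract lattice statement, nothing about any continuum limit.
References: H. Föllmer, LNM 1362 (1988), Ch. I, (2.8), (2.10), Thm. (2.13), Remark (2.17); R. L. Dobrushin,
S. B. Shlosman, J. Stat. Phys. 46 (1987) 983–1014 (finite-volume mixing conditions); H. Künsch, CMP 84 (1982) 207–222;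
H.-O. Georgii, *Gibbs Measures and Phase Transitions* (2011), Thm. 8.20, §8.2; the tree's `DobrushinMetricStates.lean`,
`DobrushinComparisonBoundary.lean`.
-/

noncomputable section
open MeasureTheory ProbabilityTheory Finset Function Filter
open scoped Topology
open Literature.Probability.LatticeModels
open Literature.Probability.LatticeModels.DobrushinMetric

namespace Summit.Ventures.YMGap.RobustBall
namespace KernelClustering

variable {V S : Type*} [MeasurableSpace S] {γ : Specification V S} {r : S → S → ℝ}
  {nbr : V → Finset V} {C : V → V → ℝ}

/-- **A finite-volume kernel is an invariant state for every usable set inside its volume**: the functional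
`f ↦ ∫ f dγ_Λ(·|η)` is monotone-normalised and invariant under `γ_x` for `x ∈ W ⊆ Λ` (consistency; Föllmer 1988,
Ch. I, (2.10); the tree's `isInvariantState_kernel` is the case `W = Λ`). [folklore] -/
theorem isInvariantState_kernel_of_subset [DecidableEq V] (hγ : IsSpecification γ)
    (hC : IsKRContraction γ r nbr C) {R : ℝ} (hr0 : ∀ a b, 0 ≤ r a b) (hrR : ∀ a b, r a b ≤ R)
    (hR : 0 ≤ R) {Λ : Finset V} {W : Set V} (hW : W ⊆ ↑Λ) (η : V → S) :
    (krDustingData hγ hC hr0 hrR hR W).IsInvariantState fun f => ∫ σ, f σ ∂(γ Λ η) := by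
  haveI := hγ.isProbability Λ η
  refine ⟨fun {f Δ M} hf hM => ?_, fun {f Δ m} hf hm => ?_, fun {f Δ} x hx hf => ?_⟩
  · obtain ⟨hfm, -, B, hB⟩ := hf
    calc ∫ σ, f σ ∂(γ Λ η) ≤ ∫ _σ, M ∂(γ Λ η) :=
          integral_mono (integrable_of_abs_le' hfm hB) (integrable_const M) hM
      _ = M := by simp
  · obtain ⟨hfm, -, B, hB⟩ := hf
    calc m = ∫ _σ, m ∂(γ Λ η) := by simp
      _ ≤ ∫ σ, f σ ∂(γ Λ η) :=
          integral_mono (integrable_const m) (integrable_of_abs_le' hfm hB) hm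
  · obtain ⟨hfm, -, B, hB⟩ := hf
    exact hγ.integral_integral_consistent (Finset.singleton_subset_iff.2 (Finset.mem_coe.1 (hW hx))) η
      (integrable_of_abs_le' hfm hB)

/-- **Tilting a finite-volume kernel by a nonnegative local density gives an invariant state on the volume minus the
support of the density**: for `g ≥ 0` bounded measurable depending only on the spins in `Δ_g`, `γ_Λ(g|η) > 0` and
`x ∈ Λ ∖ Δ_g`, `γ_Λ(g · γ_x f | η) = γ_Λ(γ_x (g f) | η) = γ_Λ(g f | η)` by properness and consistency (the kernel
version of the tree's `isInvariantState_tilt`; Föllmer 1988, Ch. I, proof of Thm. (2.13) with (2.10)). [folklore] -/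
theorem isInvariantState_kernel_tilt [DecidableEq V] (hγ : IsSpecification γ)
    (hC : IsKRContraction γ r nbr C) {R : ℝ} (hr0 : ∀ a b, 0 ≤ r a b) (hrR : ∀ a b, r a b ≤ R)
    (hR : 0 ≤ R) (Λ : Finset V) (η : V → S) {g : (V → S) → ℝ} (hgm : Measurable g)
    {Δg : Finset V} (hgdep : DependsOn g (↑Δg : Set V)) (hg0 : ∀ σ, 0 ≤ g σ) {B : ℝ}
    (hgB : ∀ σ, g σ ≤ B) (hgpos : 0 < ∫ σ, g σ ∂(γ Λ η)) :
    (krDustingData hγ hC hr0 hrR hR ((↑Λ : Set V) \ ↑Δg)).IsInvariantState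
      fun f => (∫ σ, g σ * f σ ∂(γ Λ η)) / ∫ σ, g σ ∂(γ Λ η) := by
  haveI := hγ.isProbability Λ η
  have hgabs : ∀ σ, |g σ| ≤ B := fun σ => by rw [abs_of_nonneg (hg0 σ)]; exact hgB σ
  have hgi : Integrable g (γ Λ η) := integrable_of_abs_le' hgm hgabs
  have hgfi : ∀ {f : (V → S) → ℝ}, Measurable f → ∀ {M : ℝ}, (∀ σ, |f σ| ≤ M) →
      Integrable (fun σ => g σ * f σ) (γ Λ η) := fun hfm M hM =>
    hgi.mul_bdd hfm.aestronglyMeasurable (ae_of_all _ fun σ => by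
      rw [Real.norm_eq_abs]; exact hM σ)
  refine ⟨fun {f Δ M} hf hM => ?_, fun {f Δ m} hf hm => ?_, fun {f Δ} x hx hf => ?_⟩
  · obtain ⟨hfm, -, B', hB'⟩ := hf
    rw [div_le_iff₀ hgpos]
    calc ∫ σ, g σ * f σ ∂(γ Λ η) ≤ ∫ σ, g σ * M ∂(γ Λ η) :=
          integral_mono (hgfi hfm hB') (hgi.mul_const M)
            fun σ => mul_le_mul_of_nonneg_left (hM σ) (hg0 σ)
      _ = M * ∫ σ, g σ ∂(γ Λ η) := by rw [integral_mul_const, mul_comm]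
  · obtain ⟨hfm, -, B', hB'⟩ := hf
    rw [le_div_iff₀ hgpos]
    calc m * ∫ σ, g σ ∂(γ Λ η) = ∫ σ, g σ * m ∂(γ Λ η) := by rw [integral_mul_const, mul_comm]
      _ ≤ ∫ σ, g σ * f σ ∂(γ Λ η) :=
          integral_mono (hgi.mul_const m) (hgfi hfm hB')
            fun σ => mul_le_mul_of_nonneg_left (hm σ) (hg0 σ)
  · obtain ⟨hfm, -, B', hB'⟩ := hf
    have hxΛ : x ∈ Λ := Finset.mem_coe.1 hx.1
    have hxΔ : x ∉ Δg := fun h => hx.2 (Finset.mem_coe.2 h)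
    -- `g` is blind to the spin at `x`, so it commutes with `γ_x` (properness)
    have hpt : ∀ ζ, g ζ * siteAvg γ x f ζ = ∫ σ, g σ * f σ ∂(γ {x} ζ) := fun ζ => by
      rw [siteAvg, ← integral_const_mul]
      refine integral_congr_ae ?_
      filter_upwards [hγ.proper {x} ζ] with σ hσ
      rw [hgdep fun i hi => (hσ i fun hix => hxΔ ?_).symm]
      rwa [Finset.mem_singleton.1 hix] at hi
    change (∫ σ, g σ * siteAvg γ x f σ ∂(γ Λ η)) / ∫ σ, g σ ∂(γ Λ η) =
      (∫ σ, g σ * f σ ∂(γ Λ η)) / ∫ σ, g σ ∂(γ Λ η)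
    congr 1
    simp_rw [hpt]
    exact hγ.integral_integral_consistent (Finset.singleton_subset_iff.2 hxΛ) η (hgfi hfm hB')

/-- **The initial estimate `R·𝟙_Λ` for a kernel and its tilt.** For `g ≥ 0` bounded measurable with `γ_Λ(g|η) > 0`,
the vector `z ↦ R·𝟙[z ∈ Λ]` is an estimate for the pair `γ_Λ(·|η)`, `g γ_Λ(·|η)/γ_Λ(g|η)`: both are averages over
configurations frozen at `η` outside `Λ` (properness), so an admissible `f` may be replaced by the inside function
`f(·_Λ η_{Λᶜ})`, whose oscillation is at most `R Σ_{z ∈ Δ ∩ Λ} δ_z(f)` (Föllmer 1988, Ch. I, (2.3), (2.22) with the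
conditional specification (2.10)). [folklore] -/
theorem isEstimate_kernel_tilt [DecidableEq V] (hγ : IsSpecification γ)
    (hC : IsKRContraction γ r nbr C) {R : ℝ} (hr0 : ∀ a b, 0 ≤ r a b) (hrR : ∀ a b, r a b ≤ R)
    (hR : 0 ≤ R) (Λ : Finset V) (η : V → S) {g : (V → S) → ℝ} (hgm : Measurable g)
    (hg0 : ∀ σ, 0 ≤ g σ) {B : ℝ} (hgB : ∀ σ, g σ ≤ B) (hgpos : 0 < ∫ σ, g σ ∂(γ Λ η)) (W : Set V) :
    (krDustingData hγ hC hr0 hrR hR W).IsEstimate (fun f => ∫ σ, f σ ∂(γ Λ η))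
      (fun f => (∫ σ, g σ * f σ ∂(γ Λ η)) / ∫ σ, g σ ∂(γ Λ η))
      fun z => if z ∈ Λ then R else 0 := by
  intro f Δ δ hf hδ hδ0
  obtain ⟨hfm, hfdep, Bf, hBf⟩ := hf
  haveI := hγ.isProbability Λ η
  -- the inside version of `f`
  set glue : (V → S) → V → S := fun σ z => if z ∈ Λ then σ z else η z with hglue
  set h : (V → S) → ℝ := fun σ => f (glue σ) with hh
  have hglm : Measurable glue := by
    refine measurable_pi_iff.2 fun z => ?_
    by_cases hz : z ∈ Λ
    · simp only [hglue, if_pos hz]; exact measurable_pi_apply z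
    · simp only [hglue, if_neg hz]; exact measurable_const
  have hhm : Measurable h := hfm.comp hglm
  have hhB : ∀ σ, |h σ| ≤ Bf := fun σ => hBf _
  have hgabs : ∀ σ, |g σ| ≤ B := fun σ => by rw [abs_of_nonneg (hg0 σ)]; exact hgB σ
  have hgi : Integrable g (γ Λ η) := integrable_of_abs_le' hgm hgabs
  have hhi : Integrable h (γ Λ η) := integrable_of_abs_le' hhm hhB
  have hghi : Integrable (fun σ => g σ * h σ) (γ Λ η) :=
    hgi.mul_bdd hhm.aestronglyMeasurable (ae_of_all _ fun σ => by
      rw [Real.norm_eq_abs]; exact hhB σ)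
  -- properness: `f = h` a.e. under the kernel
  have hfh : ∀ᵐ σ ∂(γ Λ η), f σ = h σ := by
    filter_upwards [hγ.proper Λ η] with σ hσ
    simp only [hh]; congr 1; funext z
    by_cases hz : z ∈ Λ
    · simp only [hglue, if_pos hz]
    · simp only [hglue, if_neg hz]; exact hσ z hz
  have h1 : ∫ σ, f σ ∂(γ Λ η) = ∫ σ, h σ ∂(γ Λ η) := integral_congr_ae hfh
  have h2 : ∫ σ, g σ * f σ ∂(γ Λ η) = ∫ σ, g σ * h σ ∂(γ Λ η) :=
    integral_congr_ae (by filter_upwards [hfh] with σ hσ; rw [hσ])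
  -- the inside function is `δ`-Lipschitz inside `Λ`, constant outside, and reads `Δ ∩ Λ`
  have hhLip : IsLipBound r h fun z => if z ∈ Λ then δ z else 0 := by
    refine ⟨fun z => by split_ifs; exacts [hδ.nonneg z, le_rfl], fun z σ τ hστ => ?_⟩
    by_cases hz : z ∈ Λ
    · rw [if_pos hz]
      have hgl : ∀ w, w ≠ z → glue σ w = glue τ w := by
        intro w hw
        by_cases hwΛ : w ∈ Λ
        · simp only [hglue, if_pos hwΛ]; exact hστ w hw
        · simp only [hglue, if_neg hwΛ]
      have h1 := hδ.le z _ _ hgl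
      simp only [hglue, if_pos hz] at h1
      exact h1
    · rw [if_neg hz, zero_mul]
      have hst : glue σ = glue τ := by
        funext w
        by_cases hwΛ : w ∈ Λ
        · simp only [hglue, if_pos hwΛ]
          exact hστ w fun h' => hz (h' ▸ hwΛ)
        · simp only [hglue, if_neg hwΛ]
      simp only [hh, hst, sub_self, abs_zero, le_refl]
  have hhdep : DependsOn h (↑(Δ.filter fun z => z ∈ Λ) : Set V) := by
    intro σ τ hστ
    simp only [hh]
    refine hfdep fun w hw => ?_
    by_cases hwΛ : w ∈ Λ
    · simp only [hglue, if_pos hwΛ]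
      exact hστ w (by simp [Finset.mem_coe.1 hw, hwΛ])
    · simp only [hglue, if_neg hwΛ]
  set K : ℝ := R * ∑ z ∈ Δ.filter (fun z => z ∈ Λ), δ z with hK
  have hosc : ∀ σ τ, |h σ - h τ| ≤ K := by
    intro σ τ
    refine (abs_sub_le_mul_sum_of_dependsOn hrR hhdep (hhLip.restrict hhdep) σ τ).trans (le_of_eq ?_)
    simp only [hK]; congr 1
    refine Finset.sum_congr rfl fun z hz => ?_
    rw [Finset.mem_filter] at hz
    rw [if_pos (Finset.mem_filter.2 hz), if_pos hz.2]
  -- the two averages of `h` differ by at most `K`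
  have hup : ∀ τ, (∫ σ, h σ ∂(γ Λ η)) ≤ h τ + K := fun τ =>
    calc ∫ σ, h σ ∂(γ Λ η) ≤ ∫ _σ, h τ + K ∂(γ Λ η) :=
          integral_mono hhi (integrable_const _) fun σ => by linarith [(abs_le.1 (hosc σ τ)).2]
      _ = h τ + K := by simp
  have hdown : ∀ τ, h τ - K ≤ ∫ σ, h σ ∂(γ Λ η) := fun τ =>
    calc h τ - K = ∫ _σ, h τ - K ∂(γ Λ η) := by simp
      _ ≤ ∫ σ, h σ ∂(γ Λ η) :=
          integral_mono (integrable_const _) hhi fun σ => by linarith [(abs_le.1 (hosc τ σ)).2]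
  have hE2up : (∫ σ, g σ * h σ ∂(γ Λ η)) / ∫ σ, g σ ∂(γ Λ η) ≤ (∫ σ, h σ ∂(γ Λ η)) + K := by
    rw [div_le_iff₀ hgpos]
    calc ∫ σ, g σ * h σ ∂(γ Λ η) ≤ ∫ σ, g σ * ((∫ σ, h σ ∂(γ Λ η)) + K) ∂(γ Λ η) :=
          integral_mono hghi (hgi.mul_const _) fun τ =>
            mul_le_mul_of_nonneg_left (by linarith [hdown τ]) (hg0 τ)
      _ = ((∫ σ, h σ ∂(γ Λ η)) + K) * ∫ σ, g σ ∂(γ Λ η) := by rw [integral_mul_const, mul_comm]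
  have hE2down : (∫ σ, h σ ∂(γ Λ η)) - K ≤ (∫ σ, g σ * h σ ∂(γ Λ η)) / ∫ σ, g σ ∂(γ Λ η) := by
    rw [le_div_iff₀ hgpos]
    calc ((∫ σ, h σ ∂(γ Λ η)) - K) * ∫ σ, g σ ∂(γ Λ η) = ∫ σ, g σ * ((∫ σ, h σ ∂(γ Λ η)) - K) ∂(γ Λ η) := by
          rw [integral_mul_const, mul_comm]
      _ ≤ ∫ σ, g σ * h σ ∂(γ Λ η) :=
          integral_mono (hgi.mul_const _) hghi fun τ =>
            mul_le_mul_of_nonneg_left (by linarith [hup τ]) (hg0 τ)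
  -- assemble
  have hsum : ∑ z ∈ Δ, (if z ∈ Λ then R else 0) * δ z = K := by
    simp only [hK]; rw [Finset.mul_sum, Finset.sum_filter]
    refine Finset.sum_congr rfl fun z _ => ?_
    split_ifs <;> simp
  change |(∫ σ, f σ ∂(γ Λ η)) - (∫ σ, g σ * f σ ∂(γ Λ η)) / ∫ σ, g σ ∂(γ Λ η)| ≤ _
  rw [hsum, h1, h2, abs_le]
  constructor <;> linarith

/-- **Kernel against tilted kernel, profile form, uniformly in the volume and the boundary condition.** Under
Dobrushin's condition in the Vasserstein form with weight `0 ≤ r ≤ R` and row sums `≤ c < 1` on `Λ`, for every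
boundary condition `η`, every nonnegative bounded local density `g` (dependence set `Δ_g`, `γ_Λ(g|η) > 0`), every
profile `ℓ : V → ℕ` vanishing on `Δ_g` with `ℓ x ≤ ℓ y + 1` for `x ∉ Δ_g`, `y ∈ nbr x`, and every bounded measurable
`f` depending on `Δ_f` with Lipschitz bound `δ_f`:
`|γ_Λ(f|η) − γ_Λ(g f|η)/γ_Λ(g|η)| ≤ R Σ_{y ∈ Δ_f} c^{ℓ y} δ_f(y)` — the sweep from the estimate `R·𝟙_Λ` down to the
super-solution `R c^{ℓ}` with usable set `Λ ∖ Δ_g` (Föllmer 1988, Ch. I, (2.8) with (2.10)). [folklore] -/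
theorem abs_tilt_sub_kernel_le [DecidableEq V] (hγ : IsSpecification γ)
    (hC : IsKRContraction γ r nbr C) {R : ℝ} (hr0 : ∀ a b, 0 ≤ r a b) (hrR : ∀ a b, r a b ≤ R)
    (hR : 0 ≤ R) {c : ℝ} (hc0 : 0 ≤ c) (hc1 : c < 1) (Λ : Finset V)
    (hrow : ∀ x ∈ Λ, ∑ y ∈ nbr x, C x y ≤ c) (η : V → S) {g : (V → S) → ℝ} (hgm : Measurable g)
    {Δg : Finset V} (hgdep : DependsOn g (↑Δg : Set V)) (hg0 : ∀ σ, 0 ≤ g σ) {B : ℝ}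
    (hgB : ∀ σ, g σ ≤ B) (hgpos : 0 < ∫ σ, g σ ∂(γ Λ η)) (ℓ : V → ℕ) (hℓ0 : ∀ y ∈ Δg, ℓ y = 0)
    (hℓ : ∀ x ∉ Δg, ∀ y ∈ nbr x, ℓ x ≤ ℓ y + 1) {f : (V → S) → ℝ} (hfm : Measurable f)
    {Δf : Finset V} (hfdep : DependsOn f (↑Δf : Set V)) {Mf : ℝ} (hMf : ∀ σ, |f σ| ≤ Mf)
    {δf : V → ℝ} (hδf : IsLipBound r f δf) :
    |(∫ σ, f σ ∂(γ Λ η)) - (∫ σ, g σ * f σ ∂(γ Λ η)) / ∫ σ, g σ ∂(γ Λ η)| ≤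
      R * ∑ y ∈ Δf, c ^ ℓ y * δf y := by
  set D := krDustingData hγ hC hr0 hrR hR ((↑Λ : Set V) \ ↑Δg) with hD
  have h₁ := isInvariantState_kernel_of_subset hγ hC hr0 hrR hR (Λ := Λ) (W := (↑Λ : Set V) \ ↑Δg)
    Set.sdiff_subset η
  have h₂ := isInvariantState_kernel_tilt hγ hC hr0 hrR hR Λ η hgm hgdep hg0 hgB hgpos
  have ha := isEstimate_kernel_tilt hγ hC hr0 hrR hR Λ η hgm hg0 hgB hgpos ((↑Λ : Set V) \ ↑Δg)
  have hrowC : ∀ (a : V → ℝ) (x : V), D.rowC a x = ∑ z ∈ nbr x, C x z * a z := fun a x => by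
    change ∑ z ∈ nbr x, (if z ∈ nbr x then C x z else 0) * a z = _
    exact Finset.sum_congr rfl fun z hz => by rw [if_pos hz]
  have hmemW : ∀ {x : V}, x ∈ D.W → x ∈ Λ ∧ x ∉ Δg := fun {x} hx =>
    ⟨Finset.mem_coe.1 hx.1, fun h => hx.2 (Finset.mem_coe.2 h)⟩
  -- the profile super-solution `R c^ℓ`
  have hsol : ∀ x ∈ D.W, D.rowC (fun z => R * c ^ ℓ z) x ≤ R * c ^ ℓ x := by
    intro x hx
    obtain ⟨hxΛ, hxΔ⟩ := hmemW hx
    rw [hrowC]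
    calc ∑ z ∈ nbr x, C x z * (R * c ^ ℓ z)
        ≤ ∑ z ∈ nbr x, C x z * (R * c ^ (ℓ x - 1)) := by
          refine Finset.sum_le_sum fun z hz => mul_le_mul_of_nonneg_left ?_ (hC.nonneg x z)
          refine mul_le_mul_of_nonneg_left (pow_le_pow_of_le_one hc0 hc1.le ?_) hR
          have := hℓ x hxΔ z hz
          omega
      _ = (∑ z ∈ nbr x, C x z) * (R * c ^ (ℓ x - 1)) := (Finset.sum_mul _ _ _).symm
      _ ≤ c * (R * c ^ (ℓ x - 1)) :=
          mul_le_mul_of_nonneg_right (hrow x hxΛ) (mul_nonneg hR (pow_nonneg hc0 _))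
      _ = R * c ^ (ℓ x - 1 + 1) := by ring
      _ ≤ R * c ^ ℓ x := by
          rcases Nat.eq_zero_or_pos (ℓ x) with h0 | hpos
          · rw [h0]
            simp only [zero_tsub, zero_add, pow_one, pow_zero]
            exact mul_le_mul_of_nonneg_left hc1.le hR
          · rw [Nat.sub_add_cancel hpos]
  have key := DustingData.abs_sub_le_sum_of_superSolution_of_estimate h₁ h₂ ha
    (fun z => by
      show 0 ≤ (if z ∈ Λ then R else 0)
      split_ifs; exacts [hR, le_rfl])
    (astar := fun z => R * c ^ ℓ z) hsol (M := R) hR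
    (fun z => by
      show (if z ∈ Λ then R else 0) ≤ R * Set.indicator D.W 1 z + R * c ^ ℓ z
      by_cases hzW : z ∈ D.W
      · rw [Set.indicator_of_mem hzW, Pi.one_apply, mul_one]
        have : (if z ∈ Λ then R else 0) ≤ R := by split_ifs; exacts [le_rfl, hR]
        exact this.trans (le_add_of_nonneg_right (mul_nonneg hR (pow_nonneg hc0 _)))
      · rw [Set.indicator_of_notMem hzW, mul_zero, zero_add]
        by_cases hzΛ : z ∈ Λ
        · have hzΔ : z ∈ Δg := by
            by_contra h'
            exact hzW ⟨Finset.mem_coe.2 hzΛ, fun h'' => h' (Finset.mem_coe.1 h'')⟩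
          rw [if_pos hzΛ, hℓ0 z hzΔ, pow_zero, mul_one]
        · rw [if_neg hzΛ]; exact mul_nonneg hR (pow_nonneg hc0 _))
    hc0 hc1
    (fun x hx => by
      rw [hrowC]
      obtain ⟨hxΛ, -⟩ := hmemW hx
      refine le_trans (Finset.sum_le_sum fun z _ => ?_) (hrow x hxΛ)
      have hind : Set.indicator D.W (1 : V → ℝ) z ≤ 1 := by
        by_cases hz : z ∈ D.W
        · rw [Set.indicator_of_mem hz, Pi.one_apply]
        · rw [Set.indicator_of_notMem hz]; exact zero_le_one
      calc C x z * Set.indicator D.W 1 z ≤ C x z * 1 := mul_le_mul_of_nonneg_left hind (hC.nonneg x z)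
        _ = C x z := mul_one _)
    (f := f) (Δ := Δf) ⟨hfm, hfdep, Mf, hMf⟩ (hδf.restrict hfdep) (fun z hz => if_neg hz)
  refine key.trans (le_of_eq ?_)
  rw [Finset.mul_sum]
  refine Finset.sum_congr rfl fun z hz => ?_
  rw [if_pos hz]
  ring

/-- **Covariance decay under the finite-volume kernels, uniformly in the volume and the boundary condition**
(Föllmer 1988, Ch. I, Thm. (2.13) in the Vasserstein form (2.23), for the conditional specification (2.10); Künsch
1982; the covariance form of Dobrushin–Shlosman's finite-volume mixing condition for Lipschitz observables): if the
one-site kernels of `γ` satisfy Dobrushin's condition in the Vasserstein form for a weight `0 ≤ r ≤ R` with row sums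
`∑_{y ∈ nbr x} C x y ≤ c < 1` for `x ∈ Λ`, then for EVERY finite volume `Λ`, EVERY boundary condition `η`, bounded
measurable local observables `f, g` with finite coordinatewise Lipschitz constants `δ_f, δ_g`, and every profile
`ℓ : V → ℕ` with `ℓ = 0` on the dependence set `Δ_g` of `g` and `ℓ x ≤ ℓ y + 1` whenever `y ∈ nbr x`, `x ∉ Δ_g`:
`|cov_{γ_Λ(·|η)}(f, g)| ≤ 2 R² (∑_y δ_y(g)) ∑_{y ∈ Δ_f} c^{ℓ(y)} δ_y(f)` — the same bound as the tree's
`abs_covariance_le_of_isKRContraction` for Gibbs measures. Proof: `cov(f, g) = γ_Λ(g̃|η)(γ_Λ^{g̃}(f|η) − γ_Λ(f|η))`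
for the tilt by `g̃ = g − g(τ₀) + R Σ δ_g ∈ [0, 2R Σ δ_g]` and `abs_tilt_sub_kernel_le`. [folklore] -/
theorem abs_covariance_kernel_le [DecidableEq V] (hγ : IsSpecification γ)
    (hC : IsKRContraction γ r nbr C) {R : ℝ} (hr0 : ∀ a b, 0 ≤ r a b) (hrR : ∀ a b, r a b ≤ R)
    (hR : 0 ≤ R) {c : ℝ} (hc0 : 0 ≤ c) (hc1 : c < 1) (Λ : Finset V)
    (hrow : ∀ x ∈ Λ, ∑ y ∈ nbr x, C x y ≤ c) (η : V → S) {f g : (V → S) → ℝ} (hfm : Measurable f)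
    {Δf : Finset V} (hfdep : DependsOn f (↑Δf : Set V)) {Mf : ℝ} (hMf : ∀ σ, |f σ| ≤ Mf)
    {δf : V → ℝ} (hδf : IsLipBound r f δf) (hgm : Measurable g) {Δg : Finset V}
    (hgdep : DependsOn g (↑Δg : Set V)) {Mg : ℝ} (hMg : ∀ σ, |g σ| ≤ Mg) {δg : V → ℝ}
    (hδg : IsLipBound r g δg) (ℓ : V → ℕ) (hℓ0 : ∀ y ∈ Δg, ℓ y = 0)
    (hℓ : ∀ x ∉ Δg, ∀ y ∈ nbr x, ℓ x ≤ ℓ y + 1) :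
    |cov[f, g; γ Λ η]| ≤ 2 * R ^ 2 * (∑ y ∈ Δg, δg y) * ∑ y ∈ Δf, c ^ ℓ y * δf y := by
  haveI := hγ.isProbability Λ η
  obtain ⟨τ₀, -⟩ := nonempty_of_measure_ne_zero (μ := γ Λ η) (s := Set.univ) (by simp)
  -- the shifted density `g̃ ∈ [0, 2 S_g]`
  set Sg : ℝ := R * ∑ y ∈ Δg, δg y with hSg
  have hSg0 : 0 ≤ Sg := mul_nonneg hR (Finset.sum_nonneg fun y _ => hδg.nonneg y)
  set gt : (V → S) → ℝ := fun σ => g σ + (Sg - g τ₀) with hgt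
  have hosc : ∀ σ, |g σ - g τ₀| ≤ Sg := fun σ =>
    abs_sub_le_mul_sum_of_dependsOn hrR hgdep hδg σ τ₀
  have hgt0 : ∀ σ, 0 ≤ gt σ := fun σ => by have := (abs_le.1 (hosc σ)).1; simp only [hgt]; linarith
  have hgtB : ∀ σ, gt σ ≤ 2 * Sg := fun σ => by have := (abs_le.1 (hosc σ)).2; simp only [hgt]; linarith
  have hgtm : Measurable gt := hgm.add_const _
  have hgtdep : DependsOn gt (↑Δg : Set V) := fun σ τ h => by simp only [hgt]; rw [hgdep h]
  have hgi : Integrable g (γ Λ η) := integrable_of_abs_le' hgm hMg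
  have hfi : Integrable f (γ Λ η) := integrable_of_abs_le' hfm hMf
  have hgtabs : ∀ σ, |gt σ| ≤ 2 * Sg := fun σ => by rw [abs_of_nonneg (hgt0 σ)]; exact hgtB σ
  have hgti : Integrable gt (γ Λ η) := integrable_of_abs_le' hgtm hgtabs
  -- the right-hand side is nonnegative
  have hRHS : 0 ≤ 2 * R ^ 2 * (∑ y ∈ Δg, δg y) * ∑ y ∈ Δf, c ^ ℓ y * δf y := by
    have h1 : 0 ≤ ∑ y ∈ Δg, δg y := Finset.sum_nonneg fun y _ => hδg.nonneg y
    have h2 : 0 ≤ ∑ y ∈ Δf, c ^ ℓ y * δf y :=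
      Finset.sum_nonneg fun y _ => mul_nonneg (pow_nonneg hc0 _) (hδf.nonneg y)
    positivity
  -- `cov(f, g) = cov(f, g̃) = γ(f g̃) - γ(f) γ(g̃)`
  have hcov : cov[f, g; γ Λ η] = ∫ σ, f σ * gt σ ∂(γ Λ η) - (∫ σ, f σ ∂(γ Λ η)) * ∫ σ, gt σ ∂(γ Λ η) := by
    have h1 : cov[f, g; γ Λ η] = cov[f, gt; γ Λ η] := by
      rw [hgt, covariance_add_const_right hgi]
    rw [h1, covariance_eq_sub]
    · rfl
    · exact memLp_of_bounded (a := -Mf) (b := Mf)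
        (ae_of_all _ fun σ => abs_le.1 (hMf σ)) hfm.aestronglyMeasurable 2
    · exact memLp_of_bounded (a := -(2 * Sg)) (b := 2 * Sg)
        (ae_of_all _ fun σ => abs_le.1 (hgtabs σ)) hgtm.aestronglyMeasurable 2
  by_cases hz : ∫ σ, gt σ ∂(γ Λ η) = 0
  · -- degenerate case: `g̃ = 0` a.e., so the covariance vanishes
    have hae : gt =ᵐ[γ Λ η] 0 := (integral_eq_zero_iff_of_nonneg (fun σ => hgt0 σ) hgti).1 hz
    have hfg : ∫ σ, f σ * gt σ ∂(γ Λ η) = 0 := by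
      rw [← integral_zero (α := V → S) (μ := γ Λ η) (G := ℝ)]
      refine integral_congr_ae ?_
      filter_upwards [hae] with σ hσ
      simp [hσ]
    rw [hcov, hfg, hz, mul_zero, sub_zero, abs_zero]
    exact hRHS
  have hpos : 0 < ∫ σ, gt σ ∂(γ Λ η) := lt_of_le_of_ne (integral_nonneg hgt0) (Ne.symm hz)
  -- the comparison estimate between the kernel and its tilt by `g̃`
  have key' := abs_tilt_sub_kernel_le hγ hC hr0 hrR hR hc0 hc1 Λ hrow η hgtm hgtdep hgt0 hgtB hpos ℓ hℓ0
    hℓ hfm hfdep hMf hδf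
  -- `cov = γ(g̃) · (γ_{g̃}(f) - γ(f))`
  have hfgt : ∫ σ, f σ * gt σ ∂(γ Λ η) = ∫ σ, gt σ * f σ ∂(γ Λ η) :=
    integral_congr_ae (ae_of_all _ fun σ => mul_comm _ _)
  have hident : cov[f, g; γ Λ η] =
      (∫ σ, gt σ ∂(γ Λ η)) * ((∫ σ, gt σ * f σ ∂(γ Λ η)) / ∫ σ, gt σ ∂(γ Λ η) - ∫ σ, f σ ∂(γ Λ η)) := by
    rw [hcov, hfgt, mul_sub, mul_div_cancel₀ _ hz]
    ring
  rw [hident, abs_mul, abs_of_pos hpos, abs_sub_comm]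
  have hgtint : ∫ σ, gt σ ∂(γ Λ η) ≤ 2 * Sg := by
    calc ∫ σ, gt σ ∂(γ Λ η) ≤ ∫ _σ, 2 * Sg ∂(γ Λ η) := integral_mono hgti (integrable_const _) hgtB
      _ = 2 * Sg := by simp
  calc (∫ σ, gt σ ∂(γ Λ η)) * |(∫ σ, f σ ∂(γ Λ η)) - (∫ σ, gt σ * f σ ∂(γ Λ η)) / ∫ σ, gt σ ∂(γ Λ η)|
      ≤ (2 * Sg) * (R * ∑ y ∈ Δf, c ^ ℓ y * δf y) :=
        mul_le_mul hgtint key' (abs_nonneg _) (by positivity)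
    _ = 2 * R ^ 2 * (∑ y ∈ Δg, δg y) * ∑ y ∈ Δf, c ^ ℓ y * δf y := by
        rw [hSg]; ring

end KernelClustering
end Summit.Ventures.YMGap.RobustBall
end
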